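import Literature.Computability.AlgebraicComplexity.AndrewsForbes2022Applications
import Literature.Computability.AlgebraicComplexity.RootLifting
import Literature.Computability.AlgebraicComplexity.RazElusiveGeneralRouteProofs
import HarnessLib

/-!
# Approximative complexity, and its closure under taking roots (Bürgisser 2004, Def. 2.1 and
# Thm. 1.3 in the graph case = Remark 1(1) / Cor. 1.4 / Prop. 3.4) — PROVED, explicit constants

Topic `Computability/AlgebraicComplexity`. P. Bürgisser, *The complexity of factors of multivariate
polynomials*, Found. Comput. Math. 4 (2004) 369–396 = arXiv:1812.06828 (corrected version); used by
Chatterjee–Kumar–Ramya–Saptharishi–Tengse, *On the existence of algebraically natural proofs*,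
arXiv:2004.14147 v4, §1.3 Def. 1.12 and §5.5 (Lemma 5.10 = [B18, Thm. 1.3]), typed in the cell
val-lit (t20, NP corpus) as the input of `Literature/Barriers/ValiantsHypothesis/CKRST20ApproximativeHardness.lean`.
Honest framing: a 2004 theorem re-proved in Lean; nothing here bears on `VP ≠ VNP`, which is NOT proved.

## Content (0 named facts; every statement is a definition with body or a theorem)

* `borderComplexity f` — **approximative (border) complexity `L̲(f)`** (B04 Def. 2.1; CKRST Def.
  1.12; the "missing notion `borderComplexity`" of `StrongHypotheses/ValiantsHypothesis.lean`), in
  the tree's border vocabulary (the ALGEBRAIC `ε`-rendering; the tree's `approxComplexity` of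
  `BLMW11KroneckerApproximation` is BLMW's Zariski-closure rendering over `ℂ`, see the def): the least `s` with `f ∈ borderClass F {h | complexity h ≤ s}`
  (`AndrewsForbes2022Applications.borderClass`: some `h ∈ F((ε))[x]` of fan-in-two size `≤ s` has
  `h - f = O(ε)` coefficientwise, `LaurentPolyOrder.PolyOrdGE 1`). API: `borderComplexity_le_complexity`
  (`L̲ ≤ L`, CKRST's remark after Def. 1.12), `borderComplexity_le_of_polyOrdGE`,
  `exists_polyOrdGE_complexity_le`, `borderComplexity_le_iff_mem_borderClass`,
  `borderComplexity_aeval_le` (substitution), `borderComplexity_rename_le`,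
  `borderComplexity_le_borderComplexity_rename` (injective renamings are free both ways).
* `exists_polyOrdGE_of_isRoot`, `borderComplexity_le_of_isRoot`, `borderComplexity_le_pow_of_isRoot` —
  **Bürgisser's Thm. 1.3 for the factor `y - φ(x)` (the graph of a polynomial; B04 Remark 1(1),
  Cor. 1.4), PROVED**: over a field of characteristic zero, if `H ∈ F[x_β][y]` is nonzero and
  `H(x, φ(x)) = 0`, then `L̲(φ) ≤ (d+2)² d (L(H) + #β + 4) + (d+1) + #β` for every `d ≥ deg φ`, in
  particular `L̲(φ) ≤ (deg φ + 2)³ (L(H) + #β + 4)` — a bound that does NOT depend on `deg H` nor on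
  the multiplicity of the root, in contrast with the EXACT root closure
  `RootLifting.complexity_le_of_isRoot` (`(L(H) + deg H + deg φ + #β + 4)^7`). This is exactly the case
  of [B18, Thm. 1.3] through which it enters CKRST §5.5 (`z - f(y_S)` divides the hybrid polynomial;
  Kabanets–Impagliazzo Lemma 28) and what makes the Kabanets–Impagliazzo generator work against
  annihilators of UNBOUNDED degree under an approximative hardness hypothesis.
* The engine `exists_polyOrdGE_of_factorization` and the two Newton lemmas over an arbitrary field
  (`newton_iterate_residual_vanish`: the slow Newton iteration drives the residual to order
  `x^{r+1}`; `vanish_sub_of_approxRoots`: two approximate roots through the same simple point agree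
  to that order), the `F[[ε]]`-unit lemma `IsOrdGE.inv`, and naturality lemmas for `optionEquivLeft`.

## The proof (B04 §3.2, Prop. 3.4, followed; one substitution)

Write `H = (y - φ)^e · Q` in `F[x][y]` with `e ≥ 1` and `Q(x, φ(x)) ≠ 0` (root multiplicity), and
translate `x ↦ x + a` so that `q := Q(x, φ(x))(0) ≠ 0` (`F` infinite). Over `K = F((ε))` form
Bürgisser's perturbation `G(x, y) := H(x, y + ε) - H(0, φ(0) + ε)` (B04: "`F := f(X, Y+ε) - f(0, ε)`").
Then `G(0, φ(0)) = 0` and `ξ := ∂_y G(0, φ(0)) = ε^{e-1} · u` with `u = e·q + O(ε)` a UNIT of `F[[ε]]`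
(characteristic zero: `e·q ≠ 0`), so `φ(0)` is a SIMPLE approximate root of `G` at the origin over
`K`. SUBSTITUTION for B04's quadratic Newton iteration with power-series division: the tree's
division-free "slow" Newton iteration `z_{r+1} = z_r - ξ⁻¹ G(x, z_r)` from `z_0 = φ(0)`
(Dvir–Shpilka–Yehudayoff 2009 Lemma 3.1 / Dutta–Saxena–Sinhababu 2018 §1.3, as in
`RootLifting.lean`), run over `K`: `G(x, z_r) ≡ 0 (mod x^{r+1})`, cost `r (L(G) + 2)`
(`RootLifting.complexity_newton_iterate_le`), followed by ONE truncation at degree `d`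
(`complexity_sum_homogeneousComponent_le`, BCS Lemma 21.25). Precision (B04's "Claim: `Φ_ν` is
defined over `R`", here division-free): on the line `y = φ - ε + ε v` one has
`G(x, φ - ε + ε v) = ε^e · R(v)` with `R(v) = v^e Q(x, φ + ε v) - Q(x, φ + ε)(0)` a polynomial with
`F[[ε]][x]` coefficients, `R(1)(0) = 0`, `∂_v R(1)(0) = u`; the slow Newton iterates `v_r` of `R` from
`v_0 = 1` stay in `F[[ε]][x]` (`u⁻¹ ∈ F[[ε]]`), and `ẑ_r := φ - ε + ε v_r` is a second approximate
root of `G` through `φ(0)`; by uniqueness `z_d ≡ ẑ_d (mod x^{d+1})`, so the truncation of `z_d` is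
`φ + ε · trunc(v_d - 1) = φ + O(ε)`. The iterates `z_r` themselves have poles in `ε` above order
`x^{r+1}` (e.g. `H = (y - x)²`: `z_1 = x - x²/(2ε)`); only the truncation is integral.

## Rendering and scope notes

* `L` is the tree's `complexity` (fan-in two, all gates counted, constants free); B04 counts
  nonscalar or total operations with `M(d)` for univariate multiplication — the printed
  `O(M(d²) L)` (Remark 1(1)) and the present `O(d³ (L + n))` are the same theorem with different cost
  bookkeeping; CKRST quote the general Thm. 1.3 as "`O(deg(g)^7 · s)`" (their Lemma 5.10).
* NOT formalised: Thm. 1.3 for a general factor `g` of `f = g^e h` (B04 §3.3: minimal polynomial of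
  an algebraic power series by fast linear algebra) — not needed by CKRST §5.5, which only divides
  by `z - f(y_S)`; no named fact is introduced for it (cite [B18, Thm. 1.3] if ever needed).
* Characteristic zero is used once (`e · q ≠ 0`), as in print.

## References

* [Burgisser2004Factors] P. Bürgisser, Found. Comput. Math. 4 (2004) = arXiv:1812.06828: Def. 2.1
  (p0006 L55–62 of the corpus text `paper:arxiv-1812.06828`), Thm. 1.3 and Remark 1 (p0004 L71–90),
  Cor. 1.4 (p0004 L98–103), §3.2 Prop. 3.4 and its proof (p0009 L60–130).
* [ChatterjeeKumarRamyaSaptharishiTengse2020] arXiv:2004.14147 v4, Def. 1.12 (TeX L346–350), Lemma 5.10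
  (L1726–1729). TeX of record: cell HOME/lit/src/2004.14147/main.tex.
* [AndrewsForbes2022] Def. 2.1 (the tree's `borderClass`).
* [DuttaSaxenaSinhababu2018] §1.3, [DvirShpilkaYehudayoff2009] Lemma 3.1 (slow Newton iteration, via
  `RootLifting.lean`); [BurgisserClausenShokrollahi1997] Lemma (21.25) (homogeneous parts).
-/

noncomputable section

namespace Literature.Computability.AlgebraicComplexity

open MvPolynomial Finset

universe u v w

/-! ### Vanishing order at the origin and two Newton lemmas over an arbitrary field -/

section Newton

variable {L : Type u} [Field L] {β : Type v}

/-- Vanishing to order `j` at the origin in terms of the support. [folklore] -/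
private theorem vanish_iff' {j : ℕ} {p : MvPolynomial β L} :
    (∀ i < j, homogeneousComponent i p = 0) ↔ ∀ m ∈ p.support, j ≤ m.degree := by
  constructor
  · intro h m hm
    by_contra hlt
    push Not at hlt
    have hc := congrArg (coeff m) (h _ hlt)
    rw [coeff_homogeneousComponent, if_pos rfl, coeff_zero] at hc
    exact (mem_support_iff.1 hm) hc
  · intro h i hi
    exact homogeneousComponent_eq_zero' _ _ fun m hm => by have := h m hm; omega

/-- Vanishing orders add under multiplication. [folklore] -/
private theorem vanish_mul' {i j : ℕ} {p q : MvPolynomial β L}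
    (hp : ∀ k < i, homogeneousComponent k p = 0) (hq : ∀ k < j, homogeneousComponent k q = 0) :
    ∀ k < i + j, homogeneousComponent k (p * q) = 0 := by
  classical
  rw [vanish_iff'] at hp hq ⊢
  intro m hm
  open Pointwise in
  obtain ⟨m₁, hm₁, m₂, hm₂, rfl⟩ := Finset.mem_add.1 (support_mul p q hm)
  rw [map_add]
  exact add_le_add (hp _ hm₁) (hq _ hm₂)

/-- A right factor of any order does not lower the vanishing order. [folklore] -/
private theorem vanish_mul_right {i : ℕ} {p : MvPolynomial β L}
    (hp : ∀ k < i, homogeneousComponent k p = 0) (q : MvPolynomial β L) :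
    ∀ k < i, homogeneousComponent k (p * q) = 0 := by
  have hq : ∀ k < 0, homogeneousComponent k q = 0 := fun k hk => absurd hk (Nat.not_lt_zero k)
  simpa using vanish_mul' hp hq

/-- A left factor of any order does not lower the vanishing order. [folklore] -/
private theorem vanish_mul_left {i : ℕ} (q : MvPolynomial β L) {p : MvPolynomial β L}
    (hp : ∀ k < i, homogeneousComponent k p = 0) :
    ∀ k < i, homogeneousComponent k (q * p) = 0 := by
  rw [mul_comm]; exact vanish_mul_right hp q

/-- Sums. [folklore] -/
private theorem vanish_add {i : ℕ} {p q : MvPolynomial β L}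
    (hp : ∀ k < i, homogeneousComponent k p = 0) (hq : ∀ k < i, homogeneousComponent k q = 0) :
    ∀ k < i, homogeneousComponent k (p + q) = 0 := fun k hk => by
  rw [map_add, hp k hk, hq k hk, add_zero]

/-- Differences. [folklore] -/
private theorem vanish_sub {i : ℕ} {p q : MvPolynomial β L}
    (hp : ∀ k < i, homogeneousComponent k p = 0) (hq : ∀ k < i, homogeneousComponent k q = 0) :
    ∀ k < i, homogeneousComponent k (p - q) = 0 := fun k hk => by
  rw [map_sub, hp k hk, hq k hk, sub_zero]

/-- Weakening the order. [folklore] -/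
private theorem vanish_mono {i j : ℕ} (hij : i ≤ j) {p : MvPolynomial β L}
    (hp : ∀ k < j, homogeneousComponent k p = 0) : ∀ k < i, homogeneousComponent k p = 0 :=
  fun k hk => hp k (lt_of_lt_of_le hk hij)

/-- A polynomial with vanishing constant term vanishes to order `1`. [folklore] -/
private theorem vanish_one_iff (p : MvPolynomial β L) :
    (∀ k < 1, homogeneousComponent k p = 0) ↔ coeff 0 p = 0 := by
  constructor
  · intro h
    have := h 0 Nat.zero_lt_one
    rwa [homogeneousComponent_zero, C_eq_zero] at this
  · intro h k hk
    obtain rfl : k = 0 := by omega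
    rw [homogeneousComponent_zero, h, C_0]

/-- A polynomial minus its constant term vanishes to order `1`. [folklore] -/
private theorem vanish_sub_C' (p : MvPolynomial β L) :
    ∀ k < 1, homogeneousComponent k (p - C (coeff 0 p)) = 0 := by
  rw [vanish_one_iff, coeff_sub, coeff_zero_C, sub_self]

/-- If `z ≡ w` to order `1` then `P(z) ≡ P(w)` to order `1` (indeed to the same order), for a
polynomial `P` over `F[x]`. [folklore] -/
private theorem vanish_eval_sub_eval {i : ℕ} (P : Polynomial (MvPolynomial β L))
    {z w : MvPolynomial β L} (h : ∀ k < i, homogeneousComponent k (z - w) = 0) :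
    ∀ k < i, homogeneousComponent k (P.eval z - P.eval w) = 0 := by
  obtain ⟨t, ht⟩ := Polynomial.sub_dvd_eval_sub z w P
  rw [ht]
  exact vanish_mul_right h t

/-- Constant terms agree when the difference vanishes to order `≥ 1`. [folklore] -/
private theorem coeff_zero_eq_of_vanish {i : ℕ} (hi : 1 ≤ i) {z w : MvPolynomial β L}
    (h : ∀ k < i, homogeneousComponent k (z - w) = 0) : coeff 0 z = coeff 0 w := by
  have := (vanish_one_iff _).1 (vanish_mono hi h)
  rwa [coeff_sub, sub_eq_zero] at this

/-- **Cancelling a factor with nonzero constant term**: if `p · q` vanishes to order `j` and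
`q(0) ≠ 0` then `p` vanishes to order `j` (multiply by the truncated inverse
`q(0)⁻¹ Σ_{t<j} (1 - q/q(0))^t`, Strassen's division trick). [folklore] -/
private theorem vanish_of_mul_of_coeff_zero_ne_zero {j : ℕ} {p q : MvPolynomial β L}
    (hq : coeff 0 q ≠ 0) (h : ∀ k < j, homogeneousComponent k (p * q) = 0) :
    ∀ k < j, homogeneousComponent k p = 0 := by
  set c := coeff 0 q with hc
  set u : MvPolynomial β L := 1 - C c⁻¹ * q with hu
  have hu1 : ∀ k < 1, homogeneousComponent k u = 0 := by
    rw [vanish_one_iff, hu, coeff_sub, coeff_zero_one, coeff_C_mul, ← hc,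
      inv_mul_cancel₀ hq, sub_self]
  have huj : ∀ k < j, homogeneousComponent k (u ^ j) = 0 := by
    clear h
    induction j with
    | zero => intro k hk; exact absurd hk (Nat.not_lt_zero k)
    | succ j ih => rw [pow_succ]; exact vanish_mul' ih hu1
  -- `q · (c⁻¹ Σ_{t<j} u^t) = 1 - u^j`
  have hgeom : C c⁻¹ * q * ∑ t ∈ range j, u ^ t = 1 - u ^ j := by
    have : C c⁻¹ * q = 1 - u := by rw [hu]; ring
    rw [this, mul_comm, geom_sum_mul_neg]
  have hid : p = p * q * (C c⁻¹ * ∑ t ∈ range j, u ^ t) + p * u ^ j := by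
    have : p * q * (C c⁻¹ * ∑ t ∈ range j, u ^ t) = p * (C c⁻¹ * q * ∑ t ∈ range j, u ^ t) := by
      ring
    rw [this, hgeom]; ring
  rw [hid]
  exact vanish_add (vanish_mul_right h _) (vanish_mul_left p huj)

/-- **Slow Newton iteration, residual form** (Dvir–Shpilka–Yehudayoff 2009, Lemma 3.1;
Dutta–Saxena–Sinhababu 2018, §1.3, as in `RootLifting.newton_iterate_vanish`, but without a
reference root): if `P(c)` has vanishing constant term and the constant term `ξ` of `P'(c)` is a
nonzero scalar, the iterates `z_0 = c`, `z_{r+1} = z_r - ξ⁻¹ P(z_r)` satisfy `z_r ≡ c (mod ⟨x⟩)` and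
`P(z_r) ≡ 0 (mod ⟨x⟩^{r+1})`. [cite: Burgisser2004Factors, §3.2 (Newton iteration (3.3))] -/
theorem newton_iterate_residual_vanish (P : Polynomial (MvPolynomial β L)) (c : L)
    (hstart : coeff 0 (P.eval (C c)) = 0) {ξ : L}
    (hξ : coeff 0 ((Polynomial.derivative P).eval (C c)) = ξ) (hξ0 : ξ ≠ 0) (r : ℕ) :
    (∀ k < 1, homogeneousComponent k ((fun z => z - C ξ⁻¹ * P.eval z)^[r] (C c) - C c) = 0) ∧
      ∀ k < r + 1, homogeneousComponent k (P.eval ((fun z => z - C ξ⁻¹ * P.eval z)^[r] (C c))) = 0 := by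
  induction r with
  | zero =>
    refine ⟨fun k hk => by rw [Function.iterate_zero_apply, sub_self, map_zero], ?_⟩
    rw [Function.iterate_zero_apply, zero_add, vanish_one_iff]
    exact hstart
  | succ r ih =>
    obtain ⟨ih1, ih2⟩ := ih
    rw [Function.iterate_succ_apply']
    set z := (fun z => z - C ξ⁻¹ * P.eval z)^[r] (C c) with hz
    set D := (Polynomial.derivative P).eval z with hD
    have hδ : ∀ k < r + 1, homogeneousComponent k (-(C ξ⁻¹ * P.eval z)) = 0 := fun k hk => by
      rw [map_neg, (vanish_mul_left (C ξ⁻¹) ih2) k hk, neg_zero]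
    refine ⟨?_, ?_⟩
    · -- `z_{r+1} - c = (z_r - c) - ξ⁻¹ P(z_r)`
      have : z - C ξ⁻¹ * P.eval z - C c = (z - C c) + -(C ξ⁻¹ * P.eval z) := by ring
      rw [this]
      exact vanish_add ih1 (vanish_mono (by omega) hδ)
    · obtain ⟨k', hk'⟩ := Polynomial.binomExpansion P z (-(C ξ⁻¹ * P.eval z))
      have hzz : z + -(C ξ⁻¹ * P.eval z) = z - C ξ⁻¹ * P.eval z := by ring
      rw [hzz] at hk'
      have hinv : C ξ⁻¹ * C ξ = (1 : MvPolynomial β L) := by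
        rw [← C_mul, inv_mul_cancel₀ hξ0, C_1]
      -- `P(z_{r+1}) = -ξ⁻¹ (P'(z_r) - ξ) P(z_r) + k' (ξ⁻¹ P(z_r))²`
      have hid : P.eval (z - C ξ⁻¹ * P.eval z) =
          -(C ξ⁻¹) * ((D - C ξ) * P.eval z) + k' * (-(C ξ⁻¹ * P.eval z)) ^ 2 := by
        rw [hk', hD]
        linear_combination (-(P.eval z)) * hinv
      -- `P'(z_r) - ξ` vanishes to order `1`: `P'(z_r) ≡ P'(c)` and `P'(c)(0) = ξ`
      have h1 : ∀ k < 1, homogeneousComponent k (D - C ξ) = 0 := by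
        have e1 : D - C ξ = ((Polynomial.derivative P).eval z - (Polynomial.derivative P).eval (C c))
            + ((Polynomial.derivative P).eval (C c) - C ξ) := by rw [hD]; ring
        rw [e1]
        refine vanish_add (vanish_eval_sub_eval _ ih1) ?_
        rw [← hξ]; exact vanish_sub_C' _
      have h2 : ∀ k < r + 1 + 1, homogeneousComponent k (-(C ξ⁻¹) * ((D - C ξ) * P.eval z)) = 0 := by
        refine vanish_mul_left _ ?_
        have := vanish_mul' h1 ih2
        exact fun k hk => this k (by omega)
      have h3 : ∀ k < r + 1 + 1,
          homogeneousComponent k (k' * (-(C ξ⁻¹ * P.eval z)) ^ 2) = 0 := by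
        refine vanish_mul_left _ ?_
        rw [pow_two]
        have := vanish_mul' hδ hδ
        exact fun k hk => this k (by omega)
      rw [hid]
      exact vanish_add h2 h3

/-- **Uniqueness of approximate roots through a simple point.** If `z ≡ w ≡ c (mod ⟨x⟩)`, the
constant term `ξ` of `P'(c)` is a nonzero scalar, and both `P(z)` and `P(w)` vanish to order
`r + 1`, then `z ≡ w (mod ⟨x⟩^{r+1})`: `P(z) - P(w) = (z - w) · S` with `S(0) = ξ ≠ 0`.
[cite: Burgisser2004Factors, §3.2 (uniqueness of the power series root, implicit function theorem)] -/
theorem vanish_sub_of_approxRoots (P : Polynomial (MvPolynomial β L)) (c : L) {ξ : L}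
    (hξ : coeff 0 ((Polynomial.derivative P).eval (C c)) = ξ) (hξ0 : ξ ≠ 0)
    {z w : MvPolynomial β L} (hz1 : ∀ k < 1, homogeneousComponent k (z - C c) = 0)
    (hw1 : ∀ k < 1, homogeneousComponent k (w - C c) = 0) {r : ℕ}
    (hz : ∀ k < r + 1, homogeneousComponent k (P.eval z) = 0)
    (hw : ∀ k < r + 1, homogeneousComponent k (P.eval w) = 0) :
    ∀ k < r + 1, homogeneousComponent k (z - w) = 0 := by
  obtain ⟨k', hk'⟩ := Polynomial.binomExpansion P w (z - w)
  have hzw : w + (z - w) = z := by ring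
  rw [hzw] at hk'
  set S := (Polynomial.derivative P).eval w + k' * (z - w) with hS
  have hprod : (z - w) * S = P.eval z - P.eval w := by rw [hk', hS]; ring
  have hS0 : coeff 0 S ≠ 0 := by
    have hw1' : coeff 0 w = c := by
      have := coeff_zero_eq_of_vanish le_rfl hw1
      rwa [coeff_zero_C] at this
    have hz1' : coeff 0 z = c := by
      have := coeff_zero_eq_of_vanish le_rfl hz1
      rwa [coeff_zero_C] at this
    have hDw : coeff 0 ((Polynomial.derivative P).eval w) = ξ := by
      have := coeff_zero_eq_of_vanish le_rfl (vanish_eval_sub_eval (Polynomial.derivative P) hw1)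
      rw [this, hξ]
    rw [hS, coeff_add, hDw]
    have : coeff 0 (k' * (z - w)) = 0 := by
      rw [← constantCoeff_eq, map_mul, map_sub, constantCoeff_eq, hz1', hw1', sub_self, mul_zero]
    rw [this, add_zero]
    exact hξ0
  refine vanish_of_mul_of_coeff_zero_ne_zero hS0 ?_
  rw [hprod]
  exact vanish_sub hz hw

/-- If `q ≡ g (mod ⟨x⟩^{D+1})` then the truncations of `q` and `g` at degree `D` agree.
[folklore] -/
private theorem sum_homogeneousComponent_eq_of_vanish' {D : ℕ} {q g : MvPolynomial β L}
    (h : ∀ k < D + 1, homogeneousComponent k (q - g) = 0) :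
    ∑ i ∈ range (D + 1), homogeneousComponent i q = ∑ i ∈ range (D + 1), homogeneousComponent i g :=
  sum_congr rfl fun i hi => by
    have := h i (mem_range.1 hi)
    rwa [map_sub, sub_eq_zero] at this

/-- The truncation at degree `D ≥ deg g` of `g` is `g`. [folklore] -/
private theorem sum_homogeneousComponent_of_totalDegree_le {D : ℕ} {g : MvPolynomial β L}
    (hD : g.totalDegree ≤ D) : ∑ i ∈ range (D + 1), homogeneousComponent i g = g := by
  calc ∑ i ∈ range (D + 1), homogeneousComponent i g
      = ∑ i ∈ range (g.totalDegree + 1), homogeneousComponent i g := by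
        refine (Finset.sum_subset (Finset.range_mono (by omega)) fun i hi hi' => ?_).symm
        refine homogeneousComponent_eq_zero _ _ ?_
        simp only [mem_range, not_lt] at hi hi'
        omega
    _ = g := sum_homogeneousComponent g

end Newton

/-! ### Approximative (border) complexity in the tree's currency -/

section Approx

variable {F : Type u} [Field F] {σ : Type v} {τ : Type w}

/-- **Approximative complexity** `L̲(f)` (Bürgisser 2004, Def. 2.1; CKRST 2020, arXiv v4
Def. 1.12 "approximative circuits and complexity"): the least `s` such that some polynomial `h`
over the Laurent series field `F((ε))` with fan-in-two circuit size `complexity h ≤ s` (constants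
from `F((ε))` free, the tree's `complexity`) satisfies `h = f + O(ε)` coefficientwise — i.e. the
least `s` with `f ∈ borderClass F {h | complexity h ≤ s}` (the tree's rendering of "approximately
computes", Andrews–Forbes 2022 Def. 2.1, file `AndrewsForbes2022Applications`). RENDERING NOTE:
Bürgisser's Def. 2.1 takes constants in `k(ε)` defined at `ε = 0` and CKRST's Def. 1.12 circuits
over `𝔽(ε)` with output `ε^M f + ε^{M+1} g`; both are border computations over `F((ε)) ⊇ F(ε)` in
the present sense, so `borderComplexity f` is AT MOST the printed approximative complexity and a
lower bound on `borderComplexity` (a hardness hypothesis) implies the printed one. RELATION TO THE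
TREE'S `approxComplexity` (`BLMW11KroneckerApproximation`, BLMW 2011 Def. 9.3.1): that is the
TOPOLOGICAL rendering (Zariski closure of `{L ≤ r}` in coefficient space, over `ℂ`); Bürgisser 2004
Thm. 5.7 (after Alder 1984) proves the two renderings agree over `ℂ` — not formalised here, and
nothing below uses it.
[cite: Burgisser2004Factors, Def. 2.1; ChatterjeeKumarRamyaSaptharishiTengse2020, Def. 1.12 (arXiv v4)] -/
def borderComplexity (f : MvPolynomial σ F) : ℕ :=
  sInf {s | f ∈ borderClass F {h : MvPolynomial σ (LaurentSeries F) | complexity h ≤ s}}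

/-- Membership in the border of a size class, unfolded. [cite: AndrewsForbes2022, Def. 2.1] -/
theorem mem_borderClass_complexity_le_iff (f : MvPolynomial σ F) (s : ℕ) :
    f ∈ borderClass F {h : MvPolynomial σ (LaurentSeries F) | complexity h ≤ s} ↔
      ∃ h : MvPolynomial σ (LaurentSeries F), complexity h ≤ s ∧
        PolyOrdGE 1 (h - MvPolynomial.map (algebraMap F (LaurentSeries F)) f) := by
  simp only [borderClass, Set.mem_setOf_eq]

/-- A border computation of `f` of size `L(h)` bounds `L̲(f)`. [cite: Burgisser2004Factors, Def. 2.1] -/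
theorem borderComplexity_le_of_polyOrdGE {f : MvPolynomial σ F}
    (h : MvPolynomial σ (LaurentSeries F))
    (hh : PolyOrdGE 1 (h - MvPolynomial.map (algebraMap F (LaurentSeries F)) f)) :
    borderComplexity f ≤ complexity h :=
  Nat.sInf_le ((mem_borderClass_complexity_le_iff f _).2 ⟨h, le_rfl, hh⟩)

/-- **`L̲(f) ≤ L(f)`** (CKRST: "the approximative complexity of `f` is at most `size(f)`", take the
error term `0`; Bürgisser 2004 §2: `L̲ ≤ L`). [cite: ChatterjeeKumarRamyaSaptharishiTengse2020, Def. 1.12 (remark following it, arXiv v4)] -/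
theorem borderComplexity_le_complexity (f : MvPolynomial σ F) : borderComplexity f ≤ complexity f := by
  refine (borderComplexity_le_of_polyOrdGE (MvPolynomial.map (algebraMap F (LaurentSeries F)) f)
    ?_).trans (ArithCircuit.complexity_map_le _ f)
  rw [sub_self]
  exact PolyOrdGE.zero 1

/-- The infimum is attained: a border computation of size `≤ L̲(f)` exists. [cite: Burgisser2004Factors, Def. 2.1] -/
theorem exists_polyOrdGE_complexity_le (f : MvPolynomial σ F) :
    ∃ h : MvPolynomial σ (LaurentSeries F), complexity h ≤ borderComplexity f ∧
      PolyOrdGE 1 (h - MvPolynomial.map (algebraMap F (LaurentSeries F)) f) := by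
  have hne : {s | f ∈ borderClass F
      {h : MvPolynomial σ (LaurentSeries F) | complexity h ≤ s}}.Nonempty :=
    ⟨complexity (MvPolynomial.map (algebraMap F (LaurentSeries F)) f),
      (mem_borderClass_complexity_le_iff f _).2
        ⟨_, le_rfl, by rw [sub_self]; exact PolyOrdGE.zero 1⟩⟩
  exact (mem_borderClass_complexity_le_iff f _).1 (Nat.sInf_mem hne)

/-- `L̲(f) ≤ s` iff `f` is in the border of the size-`s` class. [cite: AndrewsForbes2022, Def. 2.1] -/
theorem borderComplexity_le_iff_mem_borderClass (f : MvPolynomial σ F) (s : ℕ) :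
    borderComplexity f ≤ s ↔
      f ∈ borderClass F {h : MvPolynomial σ (LaurentSeries F) | complexity h ≤ s} := by
  rw [mem_borderClass_complexity_le_iff]
  constructor
  · intro hs
    obtain ⟨h, hc, hh⟩ := exists_polyOrdGE_complexity_le f
    exact ⟨h, hc.trans hs, hh⟩
  · rintro ⟨h, hc, hh⟩
    exact (borderComplexity_le_of_polyOrdGE h hh).trans hc

/-- **Substitution**: `L̲(f(θ₁, …, θ_m)) ≤ L̲(f) + Σᵢ L(θᵢ)` (substitute the exact `θᵢ` into a
border computation of `f`). [cite: Burgisser2004Factors, §2 (properties of L̲: transitivity)] -/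
theorem borderComplexity_aeval_le [Fintype σ] (θ : σ → MvPolynomial τ F) (f : MvPolynomial σ F) :
    borderComplexity (aeval θ f) ≤ borderComplexity f + ∑ i, complexity (θ i) := by
  obtain ⟨h, hc, hh⟩ := exists_polyOrdGE_complexity_le f
  set ι := algebraMap F (LaurentSeries F)
  have hmap : MvPolynomial.map ι (aeval θ f) =
      aeval (fun i => MvPolynomial.map ι (θ i)) (MvPolynomial.map ι f) := by
    change MvPolynomial.map ι (bind₁ θ f) =
      bind₁ (fun i => MvPolynomial.map ι (θ i)) (MvPolynomial.map ι f)
    exact map_bind₁ ι θ f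
  refine (borderComplexity_le_of_polyOrdGE (aeval (fun i => MvPolynomial.map ι (θ i)) h) ?_).trans ?_
  · rw [hmap, ← map_sub]
    exact PolyOrdGE.bind₁ hh fun i => PolyOrdGE.map_algebraMap (θ i)
  · refine (complexity_aeval_le h _).trans ?_
    exact add_le_add hc (Finset.sum_le_sum fun i _ => ArithCircuit.complexity_map_le ι (θ i))

/-- Renaming variables does not increase `L̲`. [cite: Burgisser2004Factors, §2 (properties of L̲)] -/
theorem borderComplexity_rename_le (e : σ → τ) (f : MvPolynomial σ F) :
    borderComplexity (rename e f) ≤ borderComplexity f := by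
  obtain ⟨h, hc, hh⟩ := exists_polyOrdGE_complexity_le f
  refine (borderComplexity_le_of_polyOrdGE (rename e h) ?_).trans
    ((complexity_rename_le_holds' e h).trans hc)
  rw [map_rename, ← map_sub, rename_eq_aeval]
  exact PolyOrdGE.bind₁ hh fun i => PolyOrdGE.X (e i)

/-- An injective renaming does not decrease `L̲` either (kill the unused variables).
[cite: Burgisser2004Factors, §2 (properties of L̲)] -/
theorem borderComplexity_le_borderComplexity_rename [Fintype τ] {e : σ → τ}
    (he : Function.Injective e) (f : MvPolynomial σ F) :
    borderComplexity f ≤ borderComplexity (rename e f) := by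
  classical
  set θ : τ → MvPolynomial σ F := fun j => if hj : ∃ i, e i = j then X hj.choose else 0 with hθ
  have hθe : ∀ i, θ (e i) = X i := fun i => by
    have hex : ∃ i', e i' = e i := ⟨i, rfl⟩
    rw [hθ]; simp only [dif_pos hex]
    exact congrArg X (he hex.choose_spec)
  have hback : aeval θ (rename e f) = f := by
    rw [aeval_rename]
    have : (θ ∘ e) = X := funext hθe
    rw [this]
    exact aeval_X_left_apply f
  have hzero : ∑ j, complexity (θ j) = 0 := by
    refine Finset.sum_eq_zero fun j _ => ?_
    rw [hθ]
    dsimp only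
    split_ifs
    · exact complexity_X_holds _
    · rw [← C_0]; exact complexity_C_holds _
  calc borderComplexity f = borderComplexity (aeval θ (rename e f)) := by rw [hback]
    _ ≤ borderComplexity (rename e f) + ∑ j, complexity (θ j) := borderComplexity_aeval_le θ _
    _ = borderComplexity (rename e f) := by rw [hzero, add_zero]

end Approx

/-! ### `F((ε))`-bookkeeping: units of `F[[ε]]`, integral polynomials, truncations -/

section Laurent

variable {F : Type u} [Field F] {σ : Type v}

/-- `F((ε))` has characteristic zero when `F` has. [folklore] -/
private theorem charZero_laurentSeries [CharZero F] : CharZero (LaurentSeries F) :=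
  charZero_of_injective_algebraMap (algebraMap F (LaurentSeries F)).injective

/-- The constant coefficient of `u = a + O(ε)` is `a`. [folklore] -/
private theorem IsOrdGE.coeff_zero_eq_of_sub_C {u : LaurentSeries F} {a : F}
    (h : IsOrdGE 1 (u - HahnSeries.C a)) : u.coeff 0 = a := by
  have := h 0 zero_lt_one
  rwa [HahnSeries.coeff_sub, HahnSeries.C_apply, HahnSeries.coeff_single_same, sub_eq_zero] at this

/-- **A power series with nonzero constant term is a unit of `F[[ε]]`**: if `x = O(1)` and
`x(0) ≠ 0` then `x⁻¹ = O(1)`. [folklore] -/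
private theorem IsOrdGE.inv {x : LaurentSeries F} (hx : IsOrdGE 0 x) (h0 : x.coeff 0 ≠ 0) :
    IsOrdGE 0 x⁻¹ := by
  have hx0 : x ≠ 0 := fun h => h0 (by rw [h, HahnSeries.coeff_zero])
  have hord : x.order = 0 := by
    refine le_antisymm (HahnSeries.order_le_of_coeff_ne_zero h0) ?_
    by_contra hlt
    push Not at hlt
    exact (HahnSeries.coeff_order_eq_zero (x := x)).not.2 hx0 (hx _ hlt)
  set φ := LaurentSeries.powerSeriesPart x with hφ
  have hxφ : x = HahnSeries.ofPowerSeries ℤ F φ := by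
    have := LaurentSeries.single_order_mul_powerSeriesPart x
    rw [hord] at this
    rw [← this]
    change HahnSeries.single 0 (1 : F) * _ = _
    rw [HahnSeries.single_zero_one, one_mul]
  have hφ0 : PowerSeries.constantCoeff φ ≠ 0 := by
    rw [← PowerSeries.coeff_zero_eq_constantCoeff_apply, hφ, LaurentSeries.powerSeriesPart_coeff,
      hord, zero_add]
    exact h0
  have hinv : x⁻¹ = HahnSeries.ofPowerSeries ℤ F φ⁻¹ := by
    refine inv_eq_of_mul_eq_one_right ?_
    rw [hxφ, ← map_mul, PowerSeries.mul_inv_cancel φ hφ0, map_one]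
  rw [hinv]
  exact IsOrdGE.ofPowerSeries _

/-- `u = a + O(ε)` with `a ≠ 0` is a unit of `F[[ε]]`: `u ≠ 0` and `u⁻¹ = O(1)`. [folklore] -/
private theorem IsOrdGE.inv_of_sub_C {u : LaurentSeries F} {a : F} (h : IsOrdGE 1 (u - HahnSeries.C a))
    (ha : a ≠ 0) : u ≠ 0 ∧ IsOrdGE 0 u⁻¹ := by
  have hu0 : u.coeff 0 = a := h.coeff_zero_eq_of_sub_C
  have hu : IsOrdGE 0 u := by
    have : u = (u - HahnSeries.C a) + HahnSeries.C a := by ring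
    rw [this]
    exact (h.mono zero_le_one).add (IsOrdGE.C a)
  refine ⟨fun h' => ha ?_, hu.inv (by rw [hu0]; exact ha)⟩
  rw [← hu0, h', HahnSeries.coeff_zero]

/-- Homogeneous components of an `O(ε^k)` polynomial are `O(ε^k)`. [folklore] -/
private theorem PolyOrdGE.homogeneousComponent {k : ℤ} {p : MvPolynomial σ (LaurentSeries F)}
    (hp : PolyOrdGE k p) (i : ℕ) : PolyOrdGE k (MvPolynomial.homogeneousComponent i p) := by
  classical
  intro m
  rw [coeff_homogeneousComponent]
  split_ifs
  · exact hp m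
  · exact IsOrdGE.zero k

/-- Truncations of an `O(ε^k)` polynomial are `O(ε^k)`. [folklore] -/
private theorem PolyOrdGE.truncation {k : ℤ} {p : MvPolynomial σ (LaurentSeries F)} (hp : PolyOrdGE k p)
    (D : ℕ) : PolyOrdGE k (∑ i ∈ range (D + 1), MvPolynomial.homogeneousComponent i p) :=
  PolyOrdGE.sum fun i _ => hp.homogeneousComponent i

/-- Evaluating a polynomial with `O(1)` coefficients (over `F((ε))[x]`) at an `O(1)` polynomial
gives an `O(1)` polynomial. [folklore] -/
private theorem PolyOrdGE.polynomialEval {Q : Polynomial (MvPolynomial σ (LaurentSeries F))}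
    (hQ : ∀ i, PolyOrdGE 0 (Q.coeff i)) {z : MvPolynomial σ (LaurentSeries F)} (hz : PolyOrdGE 0 z) :
    PolyOrdGE 0 (Q.eval z) := by
  rw [Polynomial.eval_eq_sum_range]
  exact PolyOrdGE.sum fun i _ => by simpa using (hQ i).mul (hz.pow i)

/-- `Q(z) - Q(w) = O(ε)` when `z - w = O(ε)` and `Q`, `z`, `w` are `O(1)` (telescoping
`z^i - w^i = (z - w) Σ z^j w^{i-1-j}`). [folklore] -/
private theorem PolyOrdGE.polynomialEval_sub {Q : Polynomial (MvPolynomial σ (LaurentSeries F))}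
    (hQ : ∀ i, PolyOrdGE 0 (Q.coeff i)) {z w : MvPolynomial σ (LaurentSeries F)}
    (hz : PolyOrdGE 0 z) (hw : PolyOrdGE 0 w) (hzw : PolyOrdGE 1 (z - w)) :
    PolyOrdGE 1 (Q.eval z - Q.eval w) := by
  obtain ⟨t, ht⟩ := Polynomial.sub_dvd_eval_sub z w Q
  -- explicit telescoping, to control the coefficients of the quotient
  have key : Q.eval z - Q.eval w =
      ∑ i ∈ range (Q.natDegree + 1), Q.coeff i * ((∑ j ∈ range i, z ^ j * w ^ (i - 1 - j)) * (z - w)) := by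
    rw [Polynomial.eval_eq_sum_range, Polynomial.eval_eq_sum_range, ← Finset.sum_sub_distrib]
    refine Finset.sum_congr rfl fun i _ => ?_
    rw [Commute.geom_sum₂_mul (Commute.all z w) i, mul_sub]
  rw [key]
  refine PolyOrdGE.sum fun i _ => ?_
  have h1 : PolyOrdGE 0 (∑ j ∈ range i, z ^ j * w ^ (i - 1 - j)) :=
    PolyOrdGE.sum fun j _ => by simpa using (hz.pow j).mul (hw.pow (i - 1 - j))
  simpa using (hQ i).mul (h1.mul hzw)

/-- Coefficients of a polynomial over `F[x]` mapped to `F((ε))[x]` are `O(1)`. [folklore] -/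
private theorem PolyOrdGE.coeff_map_map (Q : Polynomial (MvPolynomial σ F)) (i : ℕ) :
    PolyOrdGE 0 ((Q.map (MvPolynomial.map (algebraMap F (LaurentSeries F)))).coeff i) := by
  rw [Polynomial.coeff_map]
  exact PolyOrdGE.map_algebraMap _

/-- **Integrality of the slow Newton iterates over `F[[ε]]`**: if `R` maps `O(1)` polynomials to
`O(1)` polynomials and `u⁻¹ = O(1)`, every iterate `v_{r+1} = v_r - u⁻¹ R(v_r)` from `v_0 = 1` is
`O(1)`. [cite: Burgisser2004Factors, Prop. 3.4 (proof, Claim: Φ_ν is defined over R)] -/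
theorem polyOrdGE_newton_iterate {R : Polynomial (MvPolynomial σ (LaurentSeries F))}
    (hR : ∀ v, PolyOrdGE 0 v → PolyOrdGE 0 (R.eval v)) {u : LaurentSeries F} (hu : IsOrdGE 0 u⁻¹)
    (r : ℕ) : PolyOrdGE 0 ((fun v => v - C u⁻¹ * R.eval v)^[r] (C 1)) := by
  induction r with
  | zero => rw [Function.iterate_zero_apply, C_1]; exact PolyOrdGE.one
  | succ r ih =>
    rw [Function.iterate_succ_apply']
    exact ih.sub (by simpa using (PolyOrdGE.C hu).mul (hR _ ih))

end Laurent

/-! ### `F[x][y]` bookkeeping: the distinguished variable, change of scalars, the shift `y ↦ y + a` -/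

section OptionEquiv

variable {L : Type u} [Field L] {β : Type v}

/-- `optionEquivLeft` turns the substitution `y ↦ z` (`x` fixed) into evaluation of the
univariate polynomial `H ∈ L[x][y]` at `z ∈ L[x]` (twin of the private lemma of `RootLifting`).
[folklore] -/
private theorem eval_optionEquivLeft_eq_aeval (H : MvPolynomial (Option β) L) (z : MvPolynomial β L) :
    Polynomial.eval z (optionEquivLeft L β H) = aeval (fun o : Option β => o.elim z X) H := by
  have key : ((Polynomial.aeval z : Polynomial (MvPolynomial β L) →ₐ[MvPolynomial β L]
      MvPolynomial β L).restrictScalars L).comp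
        (optionEquivLeft L β : MvPolynomial (Option β) L →ₐ[L] Polynomial (MvPolynomial β L)) =
      aeval (fun o : Option β => o.elim z X) := by
    refine MvPolynomial.algHom_ext fun o => ?_
    rcases o with _ | b
    · simp
    · simp
  have := AlgHom.congr_fun key H
  simpa [Polynomial.coe_aeval_eq_eval] using this

/-- Constants of `L[x]` pushed into `L[x][y]` along `rename some` are constant polynomials.
[folklore] -/
private theorem optionEquivLeft_rename_some (a : MvPolynomial β L) :
    optionEquivLeft L β (rename some a) = Polynomial.C a := by
  have key : ((optionEquivLeft L β : MvPolynomial (Option β) L ≃ₐ[L]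
      Polynomial (MvPolynomial β L)) : MvPolynomial (Option β) L →+* Polynomial (MvPolynomial β L)).comp
        (rename some : MvPolynomial β L →ₐ[L] MvPolynomial (Option β) L) = Polynomial.C := by
    refine MvPolynomial.ringHom_ext (fun r => ?_) (fun b => ?_)
    · simp [optionEquivLeft_C]
    · simp [optionEquivLeft_X_some]
  exact RingHom.congr_fun key a

/-- **The shift `y ↦ y + a` of the distinguished variable is composition with `X + a` in `L[x][y]`.**
[folklore] -/
private theorem optionEquivLeft_aeval_shift (a : MvPolynomial β L) (H : MvPolynomial (Option β) L) :
    optionEquivLeft L β (aeval (fun o : Option β => o.elim (X none + rename some a)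
      (fun b => X (some b))) H) =
      (optionEquivLeft L β H).comp (Polynomial.X + Polynomial.C a) := by
  have key : ((optionEquivLeft L β : MvPolynomial (Option β) L ≃ₐ[L]
      Polynomial (MvPolynomial β L)) : MvPolynomial (Option β) L →+* Polynomial (MvPolynomial β L)).comp
        (aeval (fun o : Option β => o.elim (X none + rename some a) (fun b => X (some b))) :
          MvPolynomial (Option β) L →ₐ[L] MvPolynomial (Option β) L) =
      (Polynomial.compRingHom (Polynomial.X + Polynomial.C a)).comp
        ((optionEquivLeft L β : MvPolynomial (Option β) L ≃ₐ[L] Polynomial (MvPolynomial β L)) :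
          MvPolynomial (Option β) L →+* Polynomial (MvPolynomial β L)) := by
    refine MvPolynomial.ringHom_ext (fun r => ?_) (fun o => ?_)
    · simp [optionEquivLeft_C]
    · rcases o with _ | b
      · simp [optionEquivLeft_X_none, optionEquivLeft_rename_some]
      · simp [optionEquivLeft_X_some]
  have := RingHom.congr_fun key H
  simpa [Polynomial.coe_compRingHom_apply] using this

/-- **Change of scalars commutes with `optionEquivLeft`.** [folklore] -/
private theorem optionEquivLeft_map {K : Type u} [Field K] (ι : L →+* K) (H : MvPolynomial (Option β) L) :
    optionEquivLeft K β (MvPolynomial.map ι H) =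
      Polynomial.map (MvPolynomial.map ι) (optionEquivLeft L β H) := by
  have key : ((optionEquivLeft K β : MvPolynomial (Option β) K ≃ₐ[K]
      Polynomial (MvPolynomial β K)) : MvPolynomial (Option β) K →+* Polynomial (MvPolynomial β K)).comp
        (MvPolynomial.map ι) =
      (Polynomial.mapRingHom (MvPolynomial.map ι)).comp
        ((optionEquivLeft L β : MvPolynomial (Option β) L ≃ₐ[L] Polynomial (MvPolynomial β L)) :
          MvPolynomial (Option β) L →+* Polynomial (MvPolynomial β L)) := by
    refine MvPolynomial.ringHom_ext (fun r => ?_) (fun o => ?_)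
    · simp [optionEquivLeft_C]
    · rcases o with _ | b
      · simp [optionEquivLeft_X_none]
      · simp [optionEquivLeft_X_some]
  exact RingHom.congr_fun key H

end OptionEquiv

/-! ### The core: Bürgisser's perturbation `H(x, y + ε) - H(0, ε)` and the slow Newton iteration
over `F((ε))` -/

section Core

variable {F : Type u} [Field F] [CharZero F] {β : Type v} [Fintype β]

/-- **Approximative root lifting at a good point (Bürgisser 2004, Prop. 3.4, in the form needed
here).** Let `H ∈ F[x][y]` factor as `(y - φ(x))^e · Q` with `e ≥ 1` and `Q(x, φ(x))(0) ≠ 0`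
(the root `φ` has exact multiplicity `e` and the cofactor does not vanish at the origin on the
graph). Then for every `d ≥ deg φ` some `h ∈ F((ε))[x]` with
`L(h) ≤ (d+2)² · d · (L(H) + 4) + (d+1)` satisfies `h = φ + O(ε)` — INDEPENDENTLY of `e` and of
`deg H`. Construction: `G(x, y) = H(x, y + ε) - H(0, φ(0) + ε)` has the SIMPLE approximate root
`y ≡ φ(0)` at the origin over `F((ε))` (`∂_y G(0, φ(0)) = ε^{e-1} · (e · Q(0,φ(0)) + O(ε)) ≠ 0`);
`d` slow Newton steps `z ↦ z - ξ⁻¹ G(x, z)` from `z_0 = φ(0)` and one truncation at degree `d`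
(`RootLifting`: Dvir–Shpilka–Yehudayoff / Dutta–Saxena–Sinhababu) compute `h`; the comparison
iterate `φ - ε + ε · v_d`, `v` the Newton iterates of `v^e Q(x, φ + ε v) - Q(0, φ(0)+ε)/…` over
`F[[ε]]`, shows `h ≡ φ - ε + ε v_d (mod x^{d+1})`, whence `h = φ + O(ε)`.
[cite: Burgisser2004Factors, Prop. 3.4 and Remark 1(1) (arXiv:1812.06828 §3.2)] -/
theorem exists_polyOrdGE_of_factorization (H : MvPolynomial (Option β) F) (φ : MvPolynomial β F)
    {e : ℕ} (he : 0 < e) (Q : Polynomial (MvPolynomial β F))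
    (hfac : optionEquivLeft F β H = (Polynomial.X - Polynomial.C φ) ^ e * Q)
    (hq : coeff 0 (Q.eval φ) ≠ 0) {d : ℕ} (hd : φ.totalDegree ≤ d) :
    ∃ h : MvPolynomial β (LaurentSeries F),
      complexity h ≤ (d + 2) ^ 2 * (d * (complexity H + 4)) + (d + 1) ∧
        PolyOrdGE 1 (h - MvPolynomial.map (algebraMap F (LaurentSeries F)) φ) := by
  classical
  obtain ⟨e, rfl⟩ : ∃ e', e = e' + 1 := ⟨e - 1, by omega⟩
  -- scalars
  set ι : F →+* LaurentSeries F := algebraMap F (LaurentSeries F) with hι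
  set ε : LaurentSeries F := HahnSeries.single 1 1 with hε
  have hε1 : IsOrdGE 1 ε := IsOrdGE.single 1 (1 : F)
  have hε0 : IsOrdGE 0 ε := hε1.mono zero_le_one
  have hεne : ε ≠ 0 := by rw [hε]; exact HahnSeries.single_ne_zero one_ne_zero
  -- the data over `K = F((ε))`
  set Hk : MvPolynomial (Option β) (LaurentSeries F) := MvPolynomial.map ι H with hHk
  set φk : MvPolynomial β (LaurentSeries F) := MvPolynomial.map ι φ with hφk
  set Qk : Polynomial (MvPolynomial β (LaurentSeries F)) := Q.map (MvPolynomial.map ι) with hQk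
  set P : Polynomial (MvPolynomial β (LaurentSeries F)) := optionEquivLeft _ β Hk with hPdef
  have hP : P = (Polynomial.X - Polynomial.C φk) ^ (e + 1) * Qk := by
    rw [hPdef, hHk, optionEquivLeft_map, hfac, Polynomial.map_mul, Polynomial.map_pow,
      Polynomial.map_sub, Polynomial.map_X, Polynomial.map_C]
  have hφk0 : PolyOrdGE 0 φk := PolyOrdGE.map_algebraMap φ
  have hQk0 : ∀ i, PolyOrdGE 0 (Qk.coeff i) := PolyOrdGE.coeff_map_map Q
  have hQk'0 : ∀ i, PolyOrdGE 0 ((Polynomial.derivative Qk).coeff i) := by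
    rw [hQk, Polynomial.derivative_map]
    exact PolyOrdGE.coeff_map_map _
  have hdegk : φk.totalDegree ≤ d := by
    refine le_trans ?_ hd
    rw [hφk]
    exact Finset.sup_mono (support_map_subset ι φ)
  -- the constants `q = Q(x, φ)(0)`, `κ = Q(x, φ + ε)(0)`, `κ' = ∂_y Q(x, φ + ε)(0)`, `u = e κ + ε κ'`
  set qF : F := coeff 0 (Q.eval φ) with hqF
  set κ : LaurentSeries F := coeff 0 (Qk.eval (φk + C ε)) with hκ
  set κ' : LaurentSeries F := coeff 0 ((Polynomial.derivative Qk).eval (φk + C ε)) with hκ'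
  set u : LaurentSeries F := ((e + 1 : ℕ) : LaurentSeries F) * κ + ε * κ' with hu
  have hCε : PolyOrdGE 1 (C ε : MvPolynomial β (LaurentSeries F)) := PolyOrdGE.C hε1
  have hφkε : PolyOrdGE 0 (φk + C ε) := hφk0.add (hCε.mono zero_le_one)
  have hκ0 : IsOrdGE 0 κ := (hQk0 |> PolyOrdGE.polynomialEval <| hφkε) 0
  have hκ'0 : IsOrdGE 0 κ' := (hQk'0 |> PolyOrdGE.polynomialEval <| hφkε) 0
  have hQkφk : Qk.eval φk = MvPolynomial.map ι (Q.eval φ) := by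
    rw [hQk, hφk, Polynomial.eval_map, Polynomial.eval₂_hom]
  have hκq : IsOrdGE 1 (κ - HahnSeries.C qF) := by
    have h1 : HahnSeries.C qF = coeff 0 (Qk.eval φk) := by
      rw [hQkφk, coeff_map, ← hqF, hι, algebraMap_laurentSeries_apply]
    rw [h1, hκ, ← coeff_sub]
    refine (PolyOrdGE.polynomialEval_sub hQk0 hφkε hφk0 ?_) 0
    rw [add_sub_cancel_left]
    exact hCε
  have hu1 : IsOrdGE 1 (u - HahnSeries.C (((e + 1 : ℕ) : F) * qF)) := by
    have : u - HahnSeries.C (((e + 1 : ℕ) : F) * qF) =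
        HahnSeries.C ((e + 1 : ℕ) : F) * (κ - HahnSeries.C qF) + ε * κ' := by
      rw [hu, map_mul, map_natCast]; ring
    rw [this]
    have h1 := (IsOrdGE.C ((e + 1 : ℕ) : F)).mul hκq
    have h2 := hε1.mul hκ'0
    simp only [zero_add, add_zero] at h1 h2
    exact h1.add h2
  have heq : ((e + 1 : ℕ) : F) * qF ≠ 0 := mul_ne_zero (Nat.cast_ne_zero.2 (by omega)) hq
  obtain ⟨hu0, huinv⟩ := IsOrdGE.inv_of_sub_C hu1 heq
  -- the perturbed polynomial `G(x, y) = H(x, y + ε) - c₀`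
  set cK : LaurentSeries F := coeff 0 φk with hcK
  set c₀ : LaurentSeries F := coeff 0 (P.eval (C cK + C ε)) with hc₀
  set sft : Option β → MvPolynomial (Option β) (LaurentSeries F) :=
    fun o => o.elim (X none + rename some (C ε)) fun b => X (some b) with hsft
  set G : MvPolynomial (Option β) (LaurentSeries F) := aeval sft Hk + C (-c₀) with hG
  have hPG : optionEquivLeft _ β G = P.comp (Polynomial.X + Polynomial.C (C ε)) +
      Polynomial.C (C (-c₀)) := by
    rw [hG, map_add, optionEquivLeft_aeval_shift, optionEquivLeft_C, ← hPdef]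
  have hPGeval : ∀ z, (optionEquivLeft _ β G).eval z = P.eval (z + C ε) - C c₀ := fun z => by
    rw [hPG, Polynomial.eval_add, Polynomial.eval_comp, Polynomial.eval_add, Polynomial.eval_X,
      Polynomial.eval_C, Polynomial.eval_C, C_neg, sub_eq_add_neg]
  have hPG'eval : ∀ z, (Polynomial.derivative (optionEquivLeft _ β G)).eval z =
      (Polynomial.derivative P).eval (z + C ε) := fun z => by
    rw [hPG, Polynomial.derivative_add, Polynomial.derivative_C, add_zero,
      Polynomial.derivative_comp, Polynomial.derivative_add, Polynomial.derivative_X,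
      Polynomial.derivative_C, add_zero, one_mul, Polynomial.eval_comp, Polynomial.eval_add,
      Polynomial.eval_X, Polynomial.eval_C]
  -- congruences `C cK + C ε ≡ φk + C ε (mod x)`
  have hcong : ∀ k < 1, homogeneousComponent k ((C cK + C ε) - (φk + C ε)) = 0 := by
    have : (C cK + C ε) - (φk + C ε) = -(φk - C (coeff 0 φk)) := by rw [hcK]; ring
    rw [this]
    intro k hk
    rw [map_neg, vanish_sub_C' φk k hk, neg_zero]
  -- evaluation of `P` and `P'` on the line `y = φ + ε v`
  have hPline : ∀ v : MvPolynomial β (LaurentSeries F),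
      P.eval (φk + C ε * v) = C (ε ^ (e + 1)) * (v ^ (e + 1) * Qk.eval (φk + C ε * v)) := by
    intro v
    rw [hP, Polynomial.eval_mul, Polynomial.eval_pow, Polynomial.eval_sub, Polynomial.eval_X,
      Polynomial.eval_C, add_sub_cancel_left, mul_pow, C_pow]
    ring
  have hP'line : (Polynomial.derivative P).eval (φk + C ε) =
      ((e + 1 : ℕ) : MvPolynomial β (LaurentSeries F)) * C ε ^ e * Qk.eval (φk + C ε) +
        C ε ^ (e + 1) * (Polynomial.derivative Qk).eval (φk + C ε) := by
    rw [hP, Polynomial.derivative_mul, Polynomial.derivative_pow, Polynomial.derivative_X_sub_C,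
      mul_one, Nat.add_sub_cancel]
    simp only [Polynomial.eval_add, Polynomial.eval_mul, Polynomial.eval_pow, Polynomial.eval_sub,
      Polynomial.eval_X, Polynomial.eval_C, add_sub_cancel_left]
  have hc₀κ : c₀ = ε ^ (e + 1) * κ := by
    have h1 : coeff 0 (P.eval (C cK + C ε)) = coeff 0 (P.eval (φk + C ε)) :=
      coeff_zero_eq_of_vanish le_rfl (vanish_eval_sub_eval P hcong)
    rw [hc₀, h1]
    have h2 := hPline 1
    rw [mul_one, one_pow, one_mul] at h2
    rw [h2, coeff_C_mul, hκ]
  -- `ξ = ∂_y G(0, φ(0)) = ε^e · u ≠ 0`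
  set ξ : LaurentSeries F := coeff 0 ((Polynomial.derivative (optionEquivLeft _ β G)).eval (C cK))
    with hξ
  have hξu : ξ = ε ^ e * u := by
    have h1 : coeff 0 ((Polynomial.derivative P).eval (C cK + C ε)) =
        coeff 0 ((Polynomial.derivative P).eval (φk + C ε)) :=
      coeff_zero_eq_of_vanish le_rfl (vanish_eval_sub_eval _ hcong)
    rw [hξ, hPG'eval, h1, hP'line, hu, hκ, hκ']
    rw [← constantCoeff_eq, map_add, map_mul, map_mul, map_mul, map_pow, map_pow, map_natCast,
      constantCoeff_C, constantCoeff_eq]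
    ring
  have hξ0 : ξ ≠ 0 := by
    rw [hξu]; exact mul_ne_zero (pow_ne_zero _ hεne) hu0
  -- the comparison polynomial `R(v) = v^{e+1} Q(x, φ + ε v) - κ` over `F[[ε]][x]`
  set R : Polynomial (MvPolynomial β (LaurentSeries F)) :=
    Polynomial.X ^ (e + 1) * Qk.comp (Polynomial.C φk + Polynomial.C (C ε) * Polynomial.X) -
      Polynomial.C (C κ) with hR
  have hReval : ∀ v, R.eval v = v ^ (e + 1) * Qk.eval (φk + C ε * v) - C κ := fun v => by
    rw [hR, Polynomial.eval_sub, Polynomial.eval_mul, Polynomial.eval_pow, Polynomial.eval_X,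
      Polynomial.eval_comp, Polynomial.eval_add, Polynomial.eval_mul, Polynomial.eval_C,
      Polynomial.eval_C, Polynomial.eval_X, Polynomial.eval_C]
  have hRint : ∀ v, PolyOrdGE 0 v → PolyOrdGE 0 (R.eval v) := fun v hv => by
    rw [hReval]
    refine PolyOrdGE.sub ?_ (PolyOrdGE.C hκ0)
    have h1 : PolyOrdGE 0 (φk + C ε * v) := hφk0.add (by simpa using (hCε.mono zero_le_one).mul hv)
    simpa using (hv.pow (e + 1)).mul (PolyOrdGE.polynomialEval hQk0 h1)
  have hRstart : coeff 0 (R.eval (C 1)) = 0 := by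
    rw [hReval, C_1, one_pow, one_mul, mul_one, coeff_sub, coeff_C, if_pos rfl, hκ, sub_self]
  have hR'1 : coeff 0 ((Polynomial.derivative R).eval (C 1)) = u := by
    have hd1 : Polynomial.derivative R =
        Polynomial.C ((e + 1 : ℕ) : MvPolynomial β (LaurentSeries F)) * Polynomial.X ^ e *
            Qk.comp (Polynomial.C φk + Polynomial.C (C ε) * Polynomial.X) +
          Polynomial.X ^ (e + 1) * (Polynomial.C (C ε) *
            (Polynomial.derivative Qk).comp (Polynomial.C φk + Polynomial.C (C ε) * Polynomial.X)) := by
      rw [hR, Polynomial.derivative_sub, Polynomial.derivative_C, sub_zero,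
        Polynomial.derivative_mul, Polynomial.derivative_X_pow, Nat.add_sub_cancel,
        Polynomial.derivative_comp, Polynomial.derivative_add, Polynomial.derivative_C, zero_add,
        Polynomial.derivative_C_mul_X]
    rw [hd1]
    simp only [Polynomial.eval_add, Polynomial.eval_mul, Polynomial.eval_C, Polynomial.eval_pow,
      Polynomial.eval_X, Polynomial.eval_comp, C_1, one_pow, mul_one, one_mul]
    rw [hu, hκ, hκ', ← constantCoeff_eq, map_add, map_mul, map_mul, map_natCast, constantCoeff_C,
      constantCoeff_eq]
  -- `G` on the comparison line: `G(x, φ - ε + ε v) = ε^{e+1} R(v)`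
  have hGline : ∀ v, (optionEquivLeft _ β G).eval (φk - C ε + C ε * v) =
      C (ε ^ (e + 1)) * R.eval v := fun v => by
    rw [hPGeval, hReval, hc₀κ, C_mul]
    have : φk - C ε + C ε * v + C ε = φk + C ε * v := by ring
    rw [this, hPline]
    ring
  -- the two Newton iterations
  have hstart : coeff 0 ((optionEquivLeft _ β G).eval (C cK)) = 0 := by
    rw [hPGeval, coeff_sub, coeff_C, if_pos rfl, hc₀, sub_self]
  obtain ⟨hz1, hzP⟩ := newton_iterate_residual_vanish (optionEquivLeft _ β G) cK hstart hξ.symm hξ0 d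
  set z : MvPolynomial β (LaurentSeries F) :=
    (fun z => z - C ξ⁻¹ * (optionEquivLeft _ β G).eval z)^[d] (C cK) with hz
  obtain ⟨hv1, hvR⟩ := newton_iterate_residual_vanish R 1 hRstart hR'1 hu0 d
  set v : MvPolynomial β (LaurentSeries F) := (fun v => v - C u⁻¹ * R.eval v)^[d] (C 1) with hv
  have hvint : PolyOrdGE 0 v := polyOrdGE_newton_iterate hRint huinv d
  -- the comparison iterate `ẑ = φ - ε + ε v` is an approximate root through `φ(0)`
  have hzh1 : ∀ k < 1, homogeneousComponent k (φk - C ε + C ε * v - C cK) = 0 := by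
    have : φk - C ε + C ε * v - C cK = (φk - C (coeff 0 φk)) + C ε * (v - C 1) := by
      rw [hcK, C_1]; ring
    rw [this]
    exact vanish_add (vanish_sub_C' φk) (vanish_mul_left _ hv1)
  have hzhP : ∀ k < d + 1,
      homogeneousComponent k ((optionEquivLeft _ β G).eval (φk - C ε + C ε * v)) = 0 := by
    rw [hGline]
    exact vanish_mul_left _ hvR
  have hzzh : ∀ k < d + 1, homogeneousComponent k (z - (φk - C ε + C ε * v)) = 0 :=
    vanish_sub_of_approxRoots (optionEquivLeft _ β G) cK hξ.symm hξ0 hz1 hzh1 hzP hzhP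
  -- the output: the truncation of `z` at degree `d`
  refine ⟨∑ i ∈ range (d + 1), homogeneousComponent i z, ?_, ?_⟩
  · -- size
    have hsft' : ∑ o : Option β, complexity (sft o) ≤ 1 := by
      rw [Fintype.sum_option]
      have h0 : ∑ b : β, complexity (sft (some b)) = 0 :=
        Finset.sum_eq_zero fun b _ => by rw [hsft]; exact complexity_X_holds _
      rw [h0, add_zero, hsft]
      dsimp only [Option.elim_none]
      calc complexity (X none + rename some (C ε) : MvPolynomial (Option β) (LaurentSeries F))
          ≤ complexity (X none : MvPolynomial (Option β) (LaurentSeries F)) +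
            complexity (rename some (C ε) : MvPolynomial (Option β) (LaurentSeries F)) + 1 :=
            complexity_add_le_holds _ _
        _ = 1 := by rw [complexity_X_holds, rename_C, complexity_C_holds]
    have hGc : complexity G ≤ complexity H + 2 := by
      calc complexity G ≤ complexity (aeval sft Hk) +
            complexity (C (-c₀) : MvPolynomial (Option β) (LaurentSeries F)) + 1 :=
            complexity_add_le_holds _ _
        _ ≤ (complexity Hk + ∑ o : Option β, complexity (sft o)) + 0 + 1 := by
            gcongr
            · exact complexity_aeval_le _ _
            · exact (complexity_C_holds _).le
        _ ≤ (complexity H + 1) + 0 + 1 := by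
            gcongr
            · exact ArithCircuit.complexity_map_le ι H
        _ = complexity H + 2 := by ring
    have hzc : complexity z ≤ d * (complexity G + 2) := complexity_newton_iterate_le G ξ cK d
    calc complexity (∑ i ∈ range (d + 1), homogeneousComponent i z)
        ≤ (d + 2) ^ 2 * complexity z + (d + 1) := complexity_sum_homogeneousComponent_le z d
      _ ≤ (d + 2) ^ 2 * (d * (complexity G + 2)) + (d + 1) := by gcongr
      _ ≤ (d + 2) ^ 2 * (d * (complexity H + 4)) + (d + 1) := by
          have h4 : complexity G + 2 ≤ complexity H + 4 := by omega
          exact Nat.add_le_add_right (Nat.mul_le_mul_left _ (Nat.mul_le_mul_left _ h4)) _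
  · -- precision: `trunc_d z = trunc_d ẑ = φ + ε · trunc_d (v - 1)`
    rw [sum_homogeneousComponent_eq_of_vanish' hzzh]
    have hsplit : φk - C ε + C ε * v = φk + C ε * (v - 1) := by ring
    rw [hsplit]
    simp only [map_add, Finset.sum_add_distrib]
    rw [sum_homogeneousComponent_of_totalDegree_le hdegk, add_sub_cancel_left]
    simp only [homogeneousComponent_C_mul, ← Finset.mul_sum]
    simpa using hCε.mul ((hvint.sub PolyOrdGE.one).truncation d)

end Core

/-! ### Translations `x ↦ x + a` (twins of the private lemmas of `RootLifting`) -/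

section Translate

variable {L : Type u} [Field L] {β : Type v}

/-- Translating the `x`-variables, `x_b ↦ x_b + a_b` (and `y ↦ y`), acts on `L[x][y]`
coefficientwise. [folklore] -/
private theorem optionEquivLeft_aeval_translate' (a : β → L) (G : MvPolynomial (Option β) L) :
    optionEquivLeft L β
        (aeval (fun o : Option β => o.elim (X none) fun b => X (some b) + C (a b)) G) =
      Polynomial.map ((aeval fun b : β => X b + C (a b) : MvPolynomial β L →ₐ[L] MvPolynomial β L) :
        MvPolynomial β L →+* MvPolynomial β L) (optionEquivLeft L β G) := by
  have key : ((optionEquivLeft L β : MvPolynomial (Option β) L ≃ₐ[L]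
      Polynomial (MvPolynomial β L)) : MvPolynomial (Option β) L →+* Polynomial (MvPolynomial β L)).comp
        (aeval (fun o : Option β => o.elim (X none) fun b => X (some b) + C (a b)) :
          MvPolynomial (Option β) L →ₐ[L] MvPolynomial (Option β) L) =
      (Polynomial.mapRingHom ((aeval fun b : β => X b + C (a b) :
          MvPolynomial β L →ₐ[L] MvPolynomial β L) : MvPolynomial β L →+* MvPolynomial β L)).comp
        ((optionEquivLeft L β : MvPolynomial (Option β) L ≃ₐ[L] Polynomial (MvPolynomial β L)) :
          MvPolynomial (Option β) L →+* Polynomial (MvPolynomial β L)) := by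
    refine MvPolynomial.ringHom_ext (fun r => ?_) (fun o => ?_)
    · simp [optionEquivLeft_C]
    · rcases o with _ | b
      · simp [optionEquivLeft_X_none]
      · simp [optionEquivLeft_X_some]
  exact RingHom.congr_fun key G

/-- The constant term after the translation `x ↦ x + a` is the value at `a`. [folklore] -/
private theorem constantCoeff_aeval_translate' (a : β → L) (u : MvPolynomial β L) :
    constantCoeff (aeval (fun b : β => X b + C (a b)) u) = eval a u := by
  have key : (constantCoeff : MvPolynomial β L →+* L).comp
      (aeval (R := L) fun b : β => X b + C (a b)).toRingHom = eval a := by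
    refine MvPolynomial.ringHom_ext (fun c => ?_) (fun b => ?_)
    · simp
    · simp
  exact RingHom.congr_fun key u

/-- Translating back: `x ↦ x - a` after `x ↦ x + a` is the identity. [folklore] -/
private theorem aeval_translate_neg_translate' (a : β → L) (p : MvPolynomial β L) :
    aeval (fun b : β => X b + C (-a b)) (aeval (fun b : β => X b + C (a b)) p) = p := by
  have key : (aeval fun b : β => X b + C (-a b) : MvPolynomial β L →ₐ[L] MvPolynomial β L).comp
      (aeval fun b : β => X b + C (a b)) = AlgHom.id L _ := by
    refine MvPolynomial.algHom_ext fun b => ?_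
    simp only [AlgHom.comp_apply, aeval_X, map_add, aeval_C, algebraMap_eq, AlgHom.id_apply,
      map_neg, add_assoc, neg_add_cancel, add_zero]
  exact AlgHom.congr_fun key p

/-- A substitution by polynomials of degree `≤ 1` does not raise the total degree. [folklore] -/
private theorem totalDegree_aeval_le_linear' {γ : Type*} {t : β → MvPolynomial γ L}
    (ht : ∀ b, (t b).totalDegree ≤ 1) (p : MvPolynomial β L) :
    (aeval t p).totalDegree ≤ p.totalDegree := by
  classical
  conv_lhs => rw [p.as_sum]
  rw [map_sum]
  refine totalDegree_finsetSum_le fun m hm => ?_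
  rw [aeval_monomial, algebraMap_eq]
  refine (totalDegree_mul _ _).trans ?_
  rw [totalDegree_C, zero_add]
  simp only [Finsupp.prod]
  refine (totalDegree_finsetProd _ _).trans ?_
  calc ∑ i ∈ m.support, (t i ^ m i).totalDegree ≤ ∑ i ∈ m.support, m i := by
        refine Finset.sum_le_sum fun i _ => (totalDegree_pow _ _).trans ?_
        calc m i * (t i).totalDegree ≤ m i * 1 := Nat.mul_le_mul_left _ (ht i)
          _ = m i := mul_one _
    _ ≤ p.totalDegree := by
        have := le_totalDegree hm
        simpa only [Finsupp.sum] using this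

end Translate

/-! ### The theorem: approximative complexity of a root -/

section Main

variable {F : Type u} [Field F] [CharZero F] {β : Type v} [Fintype β]

/-- Arithmetic for the coarse bound. [folklore] -/
private theorem root_bound_coarse (d c n : ℕ) :
    (d + 2) ^ 2 * (d * (c + n + 4)) + (d + 1) + n ≤ (d + 2) ^ 3 * (c + n + 4) := by
  set X := c + n + 4 with hX
  have h1 : d + 1 ≤ (d + 2) ^ 2 := by nlinarith
  have h3 : 1 ≤ X := by omega
  have hA : d + 1 ≤ (d + 2) ^ 2 * X := h1.trans (Nat.le_mul_of_pos_right _ h3)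
  have hB : n ≤ (d + 2) ^ 2 * X :=
    le_trans (by omega) (Nat.le_mul_of_pos_left X (by positivity))
  calc (d + 2) ^ 2 * (d * X) + (d + 1) + n
      ≤ (d + 2) ^ 2 * (d * X) + 2 * ((d + 2) ^ 2 * X) := by omega
    _ = (d + 2) ^ 3 * X := by ring

/-- **Closure of approximative complexity under taking roots — Bürgisser 2004, Thm. 1.3 in the
case of the graph of a polynomial (Remark 1(1), Cor. 1.4), with explicit constants.** Over a field
of characteristic zero: if `H ∈ F[x_b : b ∈ β][y]` is nonzero and `H(x, φ(x)) = 0` then for every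
`d ≥ deg φ` there is a border computation `h ∈ F((ε))[x]`, `h = φ + O(ε)`, with
`L(h) ≤ (d+2)² · d · (L(H) + #β + 4) + (d+1) + #β` — a bound INDEPENDENT of `deg H` and of the
multiplicity of the root (compare the exact root closure `complexity_le_of_isRoot`, whose bound
carries `deg H`). Reduction to `exists_polyOrdGE_of_factorization`: factor
`H = (y - φ)^e Q` with `Q(x, φ) ≠ 0` (`Polynomial.rootMultiplicity`), translate `x ↦ x + a` to a
point with `Q(a, φ(a)) ≠ 0` (`F` is infinite), and translate back (`#β` gates each way).
[cite: Burgisser2004Factors, Thm. 1.3 / Remark 1(1) / Cor. 1.4 (arXiv:1812.06828 §1.2, §3.2)] -/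
theorem exists_polyOrdGE_of_isRoot (φ : MvPolynomial β F) {H : MvPolynomial (Option β) F}
    (hH : H ≠ 0) (hroot : bind₁ (fun o : Option β => o.elim φ X) H = 0) {d : ℕ}
    (hd : φ.totalDegree ≤ d) :
    ∃ h : MvPolynomial β (LaurentSeries F),
      complexity h ≤ (d + 2) ^ 2 * (d * (complexity H + Fintype.card β + 4)) + (d + 1) +
        Fintype.card β ∧
        PolyOrdGE 1 (h - MvPolynomial.map (algebraMap F (LaurentSeries F)) φ) := by
  classical
  -- the factorisation `H = (y - φ)^e · Q₀`, `Q₀(x, φ) ≠ 0`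
  set P₀ := optionEquivLeft F β H with hP₀
  have hP₀0 : P₀ ≠ 0 := fun h0 =>
    hH ((optionEquivLeft F β).injective (by rw [← hP₀, h0, map_zero]))
  have hroot' : P₀.IsRoot φ := by
    rw [Polynomial.IsRoot.def, hP₀, eval_optionEquivLeft_eq_aeval]
    exact hroot
  set e := P₀.rootMultiplicity φ with he
  have he0 : 0 < e := (Polynomial.rootMultiplicity_pos hP₀0).2 hroot'
  set Q₀ := P₀ /ₘ (Polynomial.X - Polynomial.C φ) ^ e with hQ₀
  have hfac₀ : P₀ = (Polynomial.X - Polynomial.C φ) ^ e * Q₀ :=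
    (Polynomial.pow_mul_divByMonic_rootMultiplicity_eq P₀ φ).symm
  have hq₀ : Q₀.eval φ ≠ 0 := Polynomial.eval_divByMonic_pow_rootMultiplicity_ne_zero φ hP₀0
  -- a good point `a`: `Q₀(a, φ(a)) ≠ 0`
  obtain ⟨a, ha⟩ : ∃ a : β → F, eval a (Q₀.eval φ) ≠ 0 := by
    by_contra hcon
    push Not at hcon
    exact hq₀ (MvPolynomial.funext fun x => by rw [hcon x, map_zero])
  -- translate
  set τ : β → MvPolynomial β F := fun b => X b + C (a b) with hτ
  set H₁ : MvPolynomial (Option β) F :=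
    aeval (fun o : Option β => o.elim (X none) fun b => X (some b) + C (a b)) H with hH₁
  set φ₁ : MvPolynomial β F := aeval τ φ with hφ₁
  set Q₁ : Polynomial (MvPolynomial β F) :=
    Q₀.map ((aeval τ : MvPolynomial β F →ₐ[F] MvPolynomial β F) : MvPolynomial β F →+* MvPolynomial β F)
    with hQ₁
  have hfac₁ : optionEquivLeft F β H₁ = (Polynomial.X - Polynomial.C φ₁) ^ e * Q₁ := by
    rw [hH₁, optionEquivLeft_aeval_translate', ← hP₀, hfac₀, Polynomial.map_mul, Polynomial.map_pow,
      Polynomial.map_sub, Polynomial.map_X, Polynomial.map_C, ← hQ₁]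
    rfl
  have hq₁ : coeff 0 (Q₁.eval φ₁) ≠ 0 := by
    have h1 : Q₁.eval φ₁ = aeval τ (Q₀.eval φ) := by
      rw [hQ₁, hφ₁, Polynomial.eval_map, ← AlgHom.coe_toRingHom, Polynomial.eval₂_hom]
    rw [h1, ← constantCoeff_eq, constantCoeff_aeval_translate']
    exact ha
  have hd₁ : φ₁.totalDegree ≤ d := by
    refine le_trans (totalDegree_aeval_le_linear' (fun b => ?_) φ) hd
    refine (totalDegree_add _ _).trans (max_le (totalDegree_X _).le ?_)
    rw [totalDegree_C]; exact zero_le_one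
  have hH₁c : complexity H₁ ≤ complexity H + Fintype.card β := by
    refine (complexity_aeval_le H _).trans ?_
    rw [Fintype.sum_option]
    simp only [Option.elim_none, Option.elim_some]
    rw [complexity_X_holds none, zero_add]
    gcongr
    calc ∑ b : β, complexity (X (some b) + C (a b) : MvPolynomial (Option β) F)
        ≤ ∑ _b : β, 1 := Finset.sum_le_sum fun b _ => by
          calc complexity (X (some b) + C (a b) : MvPolynomial (Option β) F)
              ≤ complexity (X (some b) : MvPolynomial (Option β) F) +
                complexity (C (a b) : MvPolynomial (Option β) F) + 1 := complexity_add_le_holds _ _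
            _ = 1 := by rw [complexity_X_holds, complexity_C_holds]
      _ = Fintype.card β := by simp
  -- the core at the good point
  obtain ⟨h₁, hc₁, hh₁⟩ := exists_polyOrdGE_of_factorization H₁ φ₁ he0 Q₁ hfac₁ hq₁ hd₁
  -- translate back over `F((ε))`
  set ι := algebraMap F (LaurentSeries F) with hι
  set θ : β → MvPolynomial β (LaurentSeries F) := fun b => X b + C (-(ι (a b))) with hθ
  refine ⟨aeval θ h₁, ?_, ?_⟩
  · have hθc : ∑ b : β, complexity (θ b) ≤ Fintype.card β := by
      calc ∑ b : β, complexity (θ b) ≤ ∑ _b : β, 1 := Finset.sum_le_sum fun b _ => by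
            calc complexity (θ b) ≤ complexity (X b : MvPolynomial β (LaurentSeries F)) +
                  complexity (C (-(ι (a b))) : MvPolynomial β (LaurentSeries F)) + 1 :=
                  complexity_add_le_holds _ _
              _ = 1 := by rw [complexity_X_holds, complexity_C_holds]
        _ = Fintype.card β := by simp
    calc complexity (aeval θ h₁) ≤ complexity h₁ + ∑ b : β, complexity (θ b) :=
          complexity_aeval_le _ _
      _ ≤ ((d + 2) ^ 2 * (d * (complexity H₁ + 4)) + (d + 1)) + Fintype.card β :=
          add_le_add hc₁ hθc
      _ ≤ (d + 2) ^ 2 * (d * (complexity H + Fintype.card β + 4)) + (d + 1) + Fintype.card β := by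
          have : complexity H₁ + 4 ≤ complexity H + Fintype.card β + 4 := by omega
          exact Nat.add_le_add_right (Nat.add_le_add_right
            (Nat.mul_le_mul_left _ (Nat.mul_le_mul_left _ this)) _) _
  · have hback : MvPolynomial.map ι φ = aeval θ (MvPolynomial.map ι φ₁) := by
      rw [hφ₁]
      change MvPolynomial.map ι φ = aeval θ (MvPolynomial.map ι (bind₁ τ φ))
      rw [map_bind₁]
      have hτ' : (fun b => MvPolynomial.map ι (τ b)) =
          fun b => (X b + C (ι (a b)) : MvPolynomial β (LaurentSeries F)) := by
        funext b; rw [hτ]; simp only [map_add, map_X, map_C]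
      rw [hτ', hθ]
      exact (aeval_translate_neg_translate' (fun b => ι (a b)) _).symm
    rw [hback, ← map_sub]
    refine PolyOrdGE.bind₁ hh₁ fun b => ?_
    rw [hθ]
    refine (PolyOrdGE.X b).add (PolyOrdGE.C ?_)
    rw [← map_neg, hι, algebraMap_laurentSeries_apply]
    exact IsOrdGE.C _

/-- **Bürgisser's theorem for roots, fine form:** `L̲(φ) ≤ (d+2)² d (L(H) + #β + 4) + (d+1) + #β`
for every `d ≥ deg φ`, whenever `φ` is a root of a nonzero `H(x, y)` — independently of `deg H`
and of the multiplicity of the root. [cite: Burgisser2004Factors, Thm. 1.3 / Remark 1(1) / Cor. 1.4 (arXiv:1812.06828)] -/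
theorem borderComplexity_le_of_isRoot (φ : MvPolynomial β F) {H : MvPolynomial (Option β) F}
    (hH : H ≠ 0) (hroot : bind₁ (fun o : Option β => o.elim φ X) H = 0) {d : ℕ}
    (hd : φ.totalDegree ≤ d) :
    borderComplexity φ ≤
      (d + 2) ^ 2 * (d * (complexity H + Fintype.card β + 4)) + (d + 1) + Fintype.card β := by
  obtain ⟨h, hc, hh⟩ := exists_polyOrdGE_of_isRoot φ hH hroot hd
  exact (borderComplexity_le_of_polyOrdGE h hh).trans hc

/-- **Bürgisser's theorem for roots, coarse form:** `L̲(φ) ≤ (deg φ + 2)³ · (L(H) + #β + 4)`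
whenever `φ` is a root of a nonzero `H(x, y)` ("the approximative complexity of a factor of the
form `y - φ(x)` is polynomially bounded in `deg φ` and `L(H)`", CKRST's use of [B18, Thm. 1.3]).
[cite: Burgisser2004Factors, Thm. 1.3 / Cor. 1.4; ChatterjeeKumarRamyaSaptharishiTengse2020, Lemma 5.10 (arXiv v4 §5.5, as used)] -/
theorem borderComplexity_le_pow_of_isRoot (φ : MvPolynomial β F) {H : MvPolynomial (Option β) F}
    (hH : H ≠ 0) (hroot : bind₁ (fun o : Option β => o.elim φ X) H = 0) :
    borderComplexity φ ≤ (φ.totalDegree + 2) ^ 3 * (complexity H + Fintype.card β + 4) :=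
  (borderComplexity_le_of_isRoot φ hH hroot le_rfl).trans (root_bound_coarse _ _ _)

end Main

end Literature.Computability.AlgebraicComplexity

end
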